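import Summits.HodgeConjecture.HodgeCM.Model.AdelicThetaDistributionMult_1

/-! PORT of `HodgeCM/Model/AdelicThetaDistributionMult.lean` (HodgeCMPerL run 82) — part 2: continuation of `Summits.HodgeConjecture.HodgeCM.Model.AdelicThetaDistributionMult_1` (split at a top-level declaration boundary by port_pkg.py; scope re-opened below; declarations unchanged). -/

-- port_pkg: scope re-opened for this part (file-level context, then the namespace/section stack open at the cut)
set_option autoImplicit false
noncomputable section
open MeasureTheory MulAction IsDedekindDomain NumberField.mixedEmbedding
open NumberField hiding relNormOneIdeles relNormOneRat probHaarRelNormOneQuot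
open Literature.NumberTheory.Automorphic Literature.NumberTheory.Weil1964
open Literature.NumberTheory.Automorphic.UnitaryGroup
open Literature.Geometry.ComplexHyperbolic.BallModel (U21 x₀)
open Literature.AlgebraicGeometry.HodgeTheory Literature.AlgebraicGeometry.ShimuraVarieties
open Literature.NumberTheory.Automorphic.PicardCM
open HodgeCM.Model.SupplyInstance HodgeCM.Model.SupplyResidual HodgeCM.Model.ThetaSpace
open scoped SchwartzMap TensorProduct Classical
namespace HodgeCM
namespace Model
namespace ThetaAdelicSide
namespace ThetaDistDatum
variable {L : CMField} {ι₁ : L →+* ℂ} {V : HermSpace3 L ι₁} {c : SeesawCtx L}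
variable {S : ThetaAdelicSide V c} {hV : IsAnisotropic L V.Hm} {k : Fin 4} (D : S.ThetaDistDatum hV k)
section Main
variable (ωar : UnitaryGroup.arch (↥(maximalRealSubfield L)) L (IsCMField.complexConj L) 3 V.Hm →
    (𝓢((Fin 3 → mixedSpace (↥(maximalRealSubfield L))), ℂ) →ₗ[ℂ] 𝓢((Fin 3 → mixedSpace (↥(maximalRealSubfield L))), ℂ)))
  (har : ∀ aa : UnitaryGroup.arch (↥(maximalRealSubfield L)) L (IsCMField.complexConj L) 3 V.Hm,
      UnitaryGroup.archAt (↥(maximalRealSubfield L)) L (IsCMField.complexConj L) 3 V.Hm (UnitaryGroup.cmPlace (L : Type) ι₁)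
          (NumberField.complexConj_smul_infinitePlace (L : Type) _) (IsCMField.complexConj_ne_one (L : Type)) aa = 1 →
      (S.P k).ω (HodgeCM.Adelic.regimeEquiv L V.Hm hV
          (UnitaryGroup.archToAdelic (↥(maximalRealSubfield L)) L (IsCMField.complexConj L) 3 V.Hm aa), 1) =
        adelicTensorEnd (K := ↥(maximalRealSubfield L)) (ι := Fin 3) (ωar aa) LinearMap.id)
  (hmult : ∀ a ∈ D.admFamilies ωar, ∃ r : ℂ, a = r • D.Φarch)
include har hmult in
/-- **Every theta form of every strict saturated situation of the slot is a value of the distribution** (modulo multiplicity one): for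
`Sit` strict, saturated at `satG hV K`, `j ∈ Sit.𝓙` and ANY weight function `f`, `θ(Sit, j, f) = D.dist f Φ_f` on `G_U(𝔸)` with ONE `K`-fixed
`Φ_f` (the same for all `f`). -/
theorem exists_coe_thetaForm_eq_dist_of_multOne (K : Subgroup ↥V.adelicFin) {Δ : Subgroup U21}
    (Sit : KTypeSituation (S.P k) S.ιinf Δ (stabilizer U21 x₀).subtype (BallForms.isPullbackCocycle_cotangentCocycle.weightOf x₀))
    (hstr : Sit.IsStrict) (hsat : Sit.IsSaturated (satG hV K))
    {j : {j : Sit.E →ₗ[ℂ] (S.P k).weilDatum.ThetaTop // (S.P k).kernelDatum.IsThetaEquivariant Sit.κ Sit.σ j}} (hj : j ∈ Sit.𝓙) :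
    ∃ Φf : FinSB (↥(maximalRealSubfield L)) (Fin 3), (∀ g ∈ K, D.ωf (g, 1) Φf = Φf) ∧
      ∀ f : C(↥(relNormOneIdeles (↥(maximalRealSubfield L)) L) ⧸ relNormOneRat (↥(maximalRealSubfield L)) L, ℂ),
        (((S.P k).kernelDatum.thetaForm (probHaarRelNormOneQuot (↥(maximalRealSubfield L)) L) (S.P k).kernelDatum_thetaLinear
            Sit.κ j.1 j.2 Sit.ι Sit.hι f : weightForms (S.P k).ΓU Sit.κ Sit.τ) :
          (V.latticeModel printFact_unitaryCompact_holds).G → (Fin 2 → ℂ)) = D.dist f Φf := by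
  obtain ⟨Φf, hfix, hfam⟩ := D.exists_fam_eq_of_multOne ωar har hmult K Sit hstr hsat hj
  exact ⟨Φf, hfix, fun f => D.coe_thetaForm_eq_dist Sit j hfam f⟩

include har hmult in
/-- **The `satG hV K`-saturated adèlic theta module of the slot is spanned by the values of the distribution** (modulo multiplicity one):
`adelicThetaSpanSat … (satG hV K) 𝓕 ≤ span {D.dist f Φ_f ∣ f ∈ 𝓕, Φ_f fixed by K}`. -/
theorem adelicThetaSpanSat_le_span_dist (K : Subgroup ↥V.adelicFin)
    (𝓕 : Set C(↥(relNormOneIdeles (↥(maximalRealSubfield L)) L) ⧸ relNormOneRat (↥(maximalRealSubfield L)) L, ℂ)) :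
    adelicThetaSpanSat (S.P k) S.ιinf (stabilizer U21 x₀).subtype (BallForms.isPullbackCocycle_cotangentCocycle.weightOf x₀)
        (satG hV K) 𝓕 ≤
      Submodule.span ℂ {F | ∃ f ∈ 𝓕, ∃ Φf : FinSB (↥(maximalRealSubfield L)) (Fin 3),
        (∀ g ∈ K, D.ωf (g, 1) Φf = Φf) ∧ F = D.dist f Φf} := by
  refine iSup_le fun Sit => Submodule.map_le_iff_le_comap.2 (Submodule.span_le.2 ?_)
  rintro θ ⟨j, hj, f, hf, rfl⟩
  obtain ⟨Φf, hfix, hfam⟩ := D.exists_fam_eq_of_multOne ωar har hmult K Sit.1 Sit.2.2 Sit.2.1 hj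
  exact Submodule.subset_span ⟨f, hf, Φf, hfix, D.coe_thetaForm_eq_dist Sit.1 j hfam f⟩

include har hmult in
/-- … with EQUALITY when `satG hV K ≤ S.Gfin` (the values `D.dist f Φ_f`, `Φ_f` fixed by `K`, are the theta forms of the product situation
`D.sitOf K hK`, #1247 `dist_mem_adelicThetaSpanSat`). -/
theorem adelicThetaSpanSat_eq_span_dist (K : Subgroup ↥V.adelicFin) (hK : satG hV K ≤ S.Gfin)
    (𝓕 : Set C(↥(relNormOneIdeles (↥(maximalRealSubfield L)) L) ⧸ relNormOneRat (↥(maximalRealSubfield L)) L, ℂ)) :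
    adelicThetaSpanSat (S.P k) S.ιinf (stabilizer U21 x₀).subtype (BallForms.isPullbackCocycle_cotangentCocycle.weightOf x₀)
        (satG hV K) 𝓕 =
      Submodule.span ℂ {F | ∃ f ∈ 𝓕, ∃ Φf : FinSB (↥(maximalRealSubfield L)) (Fin 3),
        (∀ g ∈ K, D.ωf (g, 1) Φf = Φf) ∧ F = D.dist f Φf} := by
  refine le_antisymm (D.adelicThetaSpanSat_le_span_dist ωar har hmult K 𝓕) (Submodule.span_le.2 ?_)
  rintro F ⟨f, hf, Φf, hfix, rfl⟩
  exact D.dist_mem_adelicThetaSpanSat K hK hfix hf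

include har hmult in
/-- **Single weight function**: every element of the `satG hV K`-saturated adèlic theta module of the slot with weight function `f` IS
`D.dist f Φ_f` for ONE `K`-fixed finite test vector `Φ_f` (modulo multiplicity one; `D.dist f` is linear and the `K`-fixed vectors form a
submodule).  With #1238 `biSup_adelicThetaSpan_singleton_eq` this covers any set of weight functions. -/
theorem exists_eq_dist_of_mem_adelicThetaSpanSat (K : Subgroup ↥V.adelicFin)
    (f : C(↥(relNormOneIdeles (↥(maximalRealSubfield L)) L) ⧸ relNormOneRat (↥(maximalRealSubfield L)) L, ℂ))
    {F : (V.latticeModel printFact_unitaryCompact_holds).G → (Fin 2 → ℂ)}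
    (hF : F ∈ adelicThetaSpanSat (S.P k) S.ιinf (stabilizer U21 x₀).subtype (BallForms.isPullbackCocycle_cotangentCocycle.weightOf x₀)
      (satG hV K) {f}) :
    ∃ Φf : FinSB (↥(maximalRealSubfield L)) (Fin 3), (∀ g ∈ K, D.ωf (g, 1) Φf = Φf) ∧ F = D.dist f Φf := by
  have key : ∀ F' ∈ Submodule.span ℂ {F' | ∃ f' ∈ ({f} : Set C(↥(relNormOneIdeles (↥(maximalRealSubfield L)) L) ⧸
      relNormOneRat (↥(maximalRealSubfield L)) L, ℂ)), ∃ Φf : FinSB (↥(maximalRealSubfield L)) (Fin 3),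
        (∀ g ∈ K, D.ωf (g, 1) Φf = Φf) ∧ F' = D.dist f' Φf},
      ∃ Φf : FinSB (↥(maximalRealSubfield L)) (Fin 3), (∀ g ∈ K, D.ωf (g, 1) Φf = Φf) ∧ F' = D.dist f Φf := by
    intro F' hF'
    induction hF' using Submodule.span_induction with
    | mem F' hF' =>
      obtain ⟨f', hf', Φf, hfix, rfl⟩ := hF'
      rcases Set.mem_singleton_iff.mp hf' with rfl
      exact ⟨Φf, hfix, rfl⟩
    | zero => exact ⟨0, fun g _ => map_zero _, (map_zero _).symm⟩
    | add F₁ F₂ _ _ h₁ h₂ =>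
      obtain ⟨Φ₁, h₁f, rfl⟩ := h₁
      obtain ⟨Φ₂, h₂f, rfl⟩ := h₂
      exact ⟨Φ₁ + Φ₂, fun g hg => by rw [map_add, h₁f g hg, h₂f g hg], (map_add _ _ _).symm⟩
    | smul r F' _ h =>
      obtain ⟨Φ, hΦ, rfl⟩ := h
      exact ⟨r • Φ, fun g hg => by rw [map_smul, hΦ g hg], (map_smul _ _ _).symm⟩
  exact key F (D.adelicThetaSpanSat_le_span_dist ωar har hmult K {f} hF)

include har hmult in
/-- **The saturated hol-germ theta module at level `Γ`** (sinst-1's `holSat`, #1242) with one weight function consists of values of the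
distribution at `Γ.K`-fixed finite test vectors (modulo multiplicity one). -/
theorem exists_eq_dist_of_mem_holSat (Γ : Level V)
    (f : C(↥(relNormOneIdeles (↥(maximalRealSubfield L)) L) ⧸ relNormOneRat (↥(maximalRealSubfield L)) L, ℂ))
    {F : (V.latticeModel printFact_unitaryCompact_holds).G → (Fin 2 → ℂ)} (hF : F ∈ S.holSat hV k Γ {f}) :
    ∃ Φf : FinSB (↥(maximalRealSubfield L)) (Fin 3), (∀ g ∈ Γ.K, D.ωf (g, 1) Φf = Φf) ∧ F = D.dist f Φf :=
  D.exists_eq_dist_of_mem_adelicThetaSpanSat ωar har hmult Γ.K f hF.1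

end Main

end ThetaDistDatum
end ThetaAdelicSide

end Model
end HodgeCM

end
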